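import Summits.QuantumFields.YangMills.Theorems.BalabanUVNodesN15KingModelFullPropagatorOperatorHolder
import Summits.QuantumFields.YangMills.Theorems.BalabanUVNodesN15KingModelFullPropagatorOperatorPrinted
import Summits.QuantumFields.YangMills.Theorems.BalabanUVNodesN15KingModelFullPropagatorRateProfile

/-!
# BalabanUVNodes ∕ N15 — THE KING-MODEL RUNG, CURVED EDITION (PART T-e): THE η-RATE OF THE HÖLDER ENTRY — the two-spacing difference
# `Δ(x′) = (A₀′⁻¹(λ∘π))(x′) − (A₀⁻¹λ)(πx′)` of King's full `A = 0` propagators is Hölder of order `α` on unit cubes WITH THE RATE `θ^{K(1−α)}`: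
# `|Δ(x″) − Δ(x′)| ≤ C·θ^{K(1−α)}·|x′ − x″|^α·‖λ‖_∞` for `η ≤ |x′ − x″| ≤ 1` (unit coordinates, `θ = L^{−γ∕2}`, `0 ≤ α ≤ 1`)
# (Track A, DAG node N15 = NE2; FAN-OUT v1.1 §N15 s3 «KING-MODEL RUNG … + the one-line statement of what the curved case adds»)

HONEST FRAMING.  Count-neutral kernel bookkeeping (cell `pub-ymgap`, seat `pub-ymgap-dag-n15-e` g8; `--supports stmt-QuantumFields-20296
--as helper` = K3⁵ `SpineGivenEndpointR13SepCoP`, WORDS-141).  TEMPLATE LITERATURE, `A = 0`: King's two-spacing comparison ([King1986] p. 664 «x′ ∈ B^n(x)»,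
Prop. 3.8 (3.71) p. 664 third line: the η-rate of the HÖLDER DERIVATIVE (3.62) of the minimiser, `≤ CL^{−γk}exp[…]`), the Hölder entries of [B9] =
[Balaban1985BackgroundPropagators] Thm 3.1 (3.43) p. 397, and the η-difference template of `T4EtaRate` (which types the four sup entries (3.42) only:
header (4) «the Hölder entries (3.43)–(3.45) … are NOT given an η-rate shape»).  THIS FILE proves an η-RATE FOR THE HÖLDER ENTRY of the FULL `A = 0`
propagator pair in operator form, by INTERPOLATION between part P″'s sup rate and part T-c's Lipschitz bound — a SHAPE statement for King's (2.13)
at `A = 0`, NOT a printed proposition (King's own (3.71) line 3 is for the minimiser and Fourier-side, `MinimizerHolderDecay`); NOT Bałaban's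
`G(U)`; NOT a node discharge; nothing continuum ∕ ℝ⁴ ∕ OS ∕ mass-gap ∕ Clay.  0 `sorry`, 0 `def`, standard axioms.

THE POINT.  `Δ(x′) := (A₀′⁻¹(λ∘π))(x′) − (A₀⁻¹λ)(πx′)` (fine run `N′ = L^nL^K` points per unit block, coarse run `N = L^K`, King's pairing `π = underPtN`,
source `λ` on the coarse lattice transported as `λ∘π`, part P″'s objects).  Two bounds are in the tree: (a) SUP WITH RATE — part P″
`fullPropOp_rate_printed_sup`: `|Δ(x′)| ≤ C₁θ^K‖λ‖_∞` for every `x′`; (b) LIPSCHITZ WITHOUT RATE — part T-c `fullPropOp_lipschitz_unif` for the fine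
run and for the coarse run read through `π` (part S-a `mul_tdistT_underPtN_le`: `π` contracts distances up to a block): `|Δ(x″) − Δ(x′)| ≤
C₂·(|x′ − x″|∕N′ + 1∕N)·‖λ‖_∞` (the coarse function `(A₀⁻¹λ)∘π` is a step function at scale `η = 1∕N`, whence the `1∕N`).  For `|x′ − x″| ≥ L^n`
(`≥ η` in unit coordinates) the second is `≤ 2C₂·(|x′ − x″|∕N′)·‖λ‖_∞`, and INTERPOLATION (`X ≤ As`, `X ≤ Aq` ⇒ `X ≤ A·s^{1−α}q^α`, §1
`le_interpolate_rpow`) gives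
* §2 `twoSpacingOp_sub_le` (the rate-free Lipschitz bound (b) for ALL `x′, x″`), ★★ **`twoSpacingOp_holder_rate`** (`0 ≤ α ≤ 1`, `0 ≤ γ ≤ 1`):
  `∃ C > 0 ∀ K ≥ 1 ∀ n ≥ 1 ∀ cube 2L^e ∀ 0 < m² ≤ m₀² ∀ λ, |λ| ≤ F ∀ x′ x″, L^n ≤ |x′ − x″| → |Δ(x″) − Δ(x′)| ≤ C·(θ^K)^{1−α}·(|x′ − x″|∕N′)^α·F` —
  the Hölder quotient of order `α` of the two-spacing difference over pairs `≥ η` apart carries the RATE `θ^{K(1−α)} = L^{−γ(1−α)K∕2}` (of order one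
  at `α = 1`, the full sup rate at `α = 0`), uniformly in `K`, `n`, the volume, the mass and the source.
WHY `|x′ − x″| ≥ η` (honest): below the coarse spacing `(A₀⁻¹λ)∘π` jumps by `≍ η‖λ‖` across coarse block faces while `|x′ − x″|^α ≤ η′^α` — the
quotient has no `n`-uniform bound there; King's (3.62) quotients are taken on each run's own lattice (`x ≠ y` on the coarse one), i.e. at `|x′ − y′| ≳ η`.
WHAT THE CURVED CASE ADDS (one line): an NE2⁺ HÖLDER LAYER for Bałaban's `G(U)λ` (rate for the (3.43) entry, uniformly over `Reg335`) — neither printed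
nor typed; the interpolation above would derive it from an NE2⁺ sup layer plus the printed (rate-free) Hölder entry (3.43).
HONEST SCOPE.  (i) `A = 0`, periodic b.c., odd `L ≥ 3`, cubes `2L^e`, `K, n ≥ 1`, `0 < m² ≤ m₀²`; (ii) King's spelling of `A₀`, `A₀′`; (iii) pairs with
`L^n ≤ |x′ − x″|` (fine units); no upper restriction is needed (for `|x′ − x″| > N′` the display exceeds the sup bound anyway); (iv) rate exponent
`γ(1−α)∕2`; (v) not Bałaban's `G(U)`; not a discharge.
Locators: [King1986] (2.13) p. 653, (3.62) p. 663, Prop. 3.8 (3.71) p. 664, p. 664 («x′ ∈ B^n(x)»); [Balaban1983RegularityDecay] Theorem (1.10) p. 573;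
[Balaban1985BackgroundPropagators] Thm 3.1 (3.43) p. 397, Thm 3.14 pp. 426–427 (template).
-/

noncomputable section

namespace Summit.QuantumFields.YangMills.BalabanUVNodes.N15KingModelRung.Curved

open Real Finset Matrix
open Literature.MathematicalPhysics.QuantumFieldTheory.Balaban1983to89 (Params)
open Literature.MathematicalPhysics.QuantumFieldTheory.Balaban1983to89.B5Prop11Plancherel (Tor fine unitVec)
open Literature.MathematicalPhysics.QuantumFieldTheory.King1986 (aK aK_pos)
open Literature.MathematicalPhysics.QuantumFieldTheory.King1986.Torus (fineOp tdistT tdistT_nonneg)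

variable {d : ℕ} (L : ℕ) [NeZero L]

/-! ## §1 Interpolation -/

omit [NeZero L] in
/-- **Interpolation of two bounds**: `X ≤ A·s`, `X ≤ A·q` with `A, s, q ≥ 0` and `0 ≤ α ≤ 1` give `X ≤ A·s^{1−α}·q^α`. [folklore] -/
theorem le_interpolate_rpow {X A s q α : ℝ} (hA : 0 ≤ A) (hs : 0 ≤ s) (hq : 0 ≤ q) (hα0 : 0 ≤ α) (hα1 : α ≤ 1)
    (h1 : X ≤ A * s) (h2 : X ≤ A * q) : X ≤ A * s ^ (1 - α) * q ^ α := by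
  have hR : 0 ≤ A * s ^ (1 - α) * q ^ α := by positivity
  rcases le_or_gt X 0 with hX | hX
  · exact hX.trans hR
  · have hA0 : 0 < A := by
      rcases hA.eq_or_lt with h | h
      · rw [← h, zero_mul] at h1; linarith
      · exact h
    have hY : 0 < X / A := div_pos hX hA0
    have hYs : X / A ≤ s := by rw [div_le_iff₀ hA0, mul_comm]; exact h1
    have hYq : X / A ≤ q := by rw [div_le_iff₀ hA0, mul_comm]; exact h2
    have hsplit : X / A = (X / A) ^ (1 - α) * (X / A) ^ α := by
      rw [← Real.rpow_add hY]; norm_num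
    have hle : (X / A) ^ (1 - α) * (X / A) ^ α ≤ s ^ (1 - α) * q ^ α :=
      mul_le_mul (Real.rpow_le_rpow hY.le hYs (by linarith)) (Real.rpow_le_rpow hY.le hYq hα0)
        (Real.rpow_nonneg hY.le _) (Real.rpow_nonneg hs _)
    calc X = A * (X / A) := by field_simp
      _ = A * ((X / A) ^ (1 - α) * (X / A) ^ α) := by rw [← hsplit]
      _ ≤ A * (s ^ (1 - α) * q ^ α) := mul_le_mul_of_nonneg_left hle hA
      _ = A * s ^ (1 - α) * q ^ α := by ring

/-! ## §2 The two-spacing difference is Lipschitz above the coarse spacing, and its Hölder quotient carries a rate -/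

/-- **The rate-free two-point bound of the two-spacing difference** `Δ = A₀′⁻¹(λ∘π) − (A₀⁻¹λ)∘π`: for odd `L ≥ 3`, `a > 0`, `m₀² ≥ 0` there is
`C > 0` with `|Δ(x″) − Δ(x′)| ≤ C·(|x′ − x″|∕N′ + 1∕N)·F` for EVERY `K, n ≥ 1`, cube `2L^e`, mass `0 < m² ≤ m₀²`, `|λ| ≤ F` and all fine `x′, x″`
(part T-c `fullPropOp_lipschitz_unif` for both runs; the coarse one through King's pairing, part S-a `mul_tdistT_underPtN_le`; the `1∕N` is the
step of `(A₀⁻¹λ)∘π` across coarse block faces). [cite: Balaban1983RegularityDecay, Theorem (1.10) p.573; King1986, p.664 («x′ ∈ B^n(x)»)] -/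
theorem twoSpacingOp_sub_le (hLodd : Odd L) (hL : 2 ≤ L) {a : ℝ} (ha : 0 < a) {m0sq : ℝ} (hm0 : 0 ≤ m0sq) :
    ∃ C : ℝ, 0 < C ∧ ∀ (K : ℕ), 1 ≤ K → ∀ (n : ℕ), 1 ≤ n →
      ∀ (e : ℕ) (M : Fin (d + 1) → ℕ) [∀ μ, NeZero (M μ)], (∀ μ, M μ = 2 * L ^ e) →
      ∀ (msq : ℝ), 0 < msq → msq ≤ m0sq →
      ∀ (lam : Tor (fine (L ^ K) M) → ℝ) (F : ℝ), (∀ y, |lam y| ≤ F) → ∀ x' x'' : Tor (fine (L ^ n * L ^ K) M),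
        |(((fineOp (L ^ n * L ^ K) M (aK a L (K + n)) (((L ^ n * L ^ K : ℕ) : ℝ) ^ 2) msq)⁻¹
              *ᵥ (fun y' => lam (underPtN L K n M y'))) x''
            - ((fineOp (L ^ K) M (aK a L K) (((L ^ K : ℕ) : ℝ) ^ 2) msq)⁻¹ *ᵥ lam) (underPtN L K n M x''))
          - (((fineOp (L ^ n * L ^ K) M (aK a L (K + n)) (((L ^ n * L ^ K : ℕ) : ℝ) ^ 2) msq)⁻¹
              *ᵥ (fun y' => lam (underPtN L K n M y'))) x'
            - ((fineOp (L ^ K) M (aK a L K) (((L ^ K : ℕ) : ℝ) ^ 2) msq)⁻¹ *ᵥ lam) (underPtN L K n M x'))|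
          ≤ C * (tdistT (fine (L ^ n * L ^ K) M) x' x'' / ((L ^ n * L ^ K : ℕ) : ℝ) + 1 / ((L ^ K : ℕ) : ℝ)) * F := by
  have hL1 : 1 < L := by omega
  have hL0 : (0 : ℝ) < L := by exact_mod_cast (show 0 < L by omega)
  obtain ⟨C₂, hC₂, H₂⟩ := fullPropOp_lipschitz_unif d L ⟨hLodd, hL1⟩ ha hm0
  refine ⟨2 * C₂, by positivity, ?_⟩
  intro K hK n hn e M _ hM msq hmsq hcap lam F hF x' x''
  -- the two parameter records (fine run: `K + n` levels; coarse run: `K` levels), cube `2L^e`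
  set Pf : Params := ⟨d + 1, L, e, K + n, by omega, ⟨hLodd, hL1⟩⟩ with hPf
  set Pc : Params := ⟨d + 1, L, e, K, by omega, ⟨hLodd, hL1⟩⟩ with hPc
  have hMf : ∀ μ, M μ = Pf.sitesPerDir Pf.K := fun μ => by rw [hM μ]; simp [hPf, Params.sitesPerDir]
  have hMc : ∀ μ, M μ = Pc.sitesPerDir Pc.K := fun μ => by rw [hM μ]; simp [hPc, Params.sitesPerDir]
  have hNf : L ^ n * L ^ K = Pf.L ^ Pf.K := by simp only [hPf]; rw [pow_add, mul_comm]
  have hNc : L ^ K = Pc.L ^ Pc.K := by simp only [hPc]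
  have hFc : ∀ y', |lam (underPtN L K n M y')| ≤ F := fun y' => hF _
  -- fine run: Lipschitz in `x′`
  have hfine := H₂ Pf rfl rfl (by show 1 ≤ K + n; omega) msq hmsq.le hcap M hMf (L ^ n * L ^ K) hNf
    (fun y' => lam (underPtN L K n M y')) F hFc x' x''
  -- coarse run: Lipschitz in `πx′`, and `π` contracts distances up to a block
  have hcoarse := H₂ Pc rfl rfl hK msq hmsq.le hcap M hMc (L ^ K) hNc lam F hF (underPtN L K n M x') (underPtN L K n M x'')
  set r' : ℝ := tdistT (fine (L ^ n * L ^ K) M) x' x'' with hr'def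
  set r : ℝ := tdistT (fine (L ^ K) M) (underPtN L K n M x') (underPtN L K n M x'') with hrdef
  set N' : ℝ := ((L ^ n * L ^ K : ℕ) : ℝ) with hN'def
  set Nc : ℝ := ((L ^ K : ℕ) : ℝ) with hNcdef
  set Ln : ℝ := ((L ^ n : ℕ) : ℝ) with hLndef
  have hLn0 : 0 < Ln := by rw [hLndef]; exact_mod_cast pow_pos (show 0 < L by omega) n
  have hNc0 : 0 < Nc := by rw [hNcdef]; exact_mod_cast pow_pos (show 0 < L by omega) K
  have hN'eq : N' = Ln * Nc := by rw [hN'def, hLndef, hNcdef]; push_cast; ring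
  have hF0 : 0 ≤ F := (abs_nonneg _).trans (hF (underPtN L K n M x'))
  have hpair : Ln * r ≤ r' + (Ln - 1) := mul_tdistT_underPtN_le L K n M x' x''
  -- `r∕Nc ≤ r′∕N′ + 1∕Nc`
  have hrc : r / Nc ≤ r' / N' + 1 / Nc := by
    rw [hN'eq, div_add_div _ _ (by positivity) hNc0.ne', div_le_div_iff₀ hNc0 (by positivity)]
    have : r * (Ln * Nc * Nc) = (Ln * r) * Nc * Nc := by ring
    rw [this]
    have h2 : (r' * Nc + Ln * Nc * 1) * Nc = (r' + Ln) * Nc * Nc := by ring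
    rw [h2]
    have : (Ln * r) * Nc * Nc ≤ (r' + Ln) * Nc * Nc := by
      apply mul_le_mul_of_nonneg_right (mul_le_mul_of_nonneg_right (by linarith) hNc0.le) hNc0.le
    exact this
  -- abbreviations for the four values
  set u2 : ℝ := ((fineOp (L ^ n * L ^ K) M (aK a L (K + n)) (((L ^ n * L ^ K : ℕ) : ℝ) ^ 2) msq)⁻¹
      *ᵥ (fun y' => lam (underPtN L K n M y'))) x'' with hu2
  set u1 : ℝ := ((fineOp (L ^ n * L ^ K) M (aK a L (K + n)) (((L ^ n * L ^ K : ℕ) : ℝ) ^ 2) msq)⁻¹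
      *ᵥ (fun y' => lam (underPtN L K n M y'))) x' with hu1
  set v2 : ℝ := ((fineOp (L ^ K) M (aK a L K) (((L ^ K : ℕ) : ℝ) ^ 2) msq)⁻¹ *ᵥ lam) (underPtN L K n M x'') with hv2
  set v1 : ℝ := ((fineOp (L ^ K) M (aK a L K) (((L ^ K : ℕ) : ℝ) ^ 2) msq)⁻¹ *ᵥ lam) (underPtN L K n M x') with hv1
  have e : (u2 - v2) - (u1 - v1) = (u2 - u1) - (v2 - v1) := by ring
  rw [e]
  have hq0 : 0 ≤ r' / N' := div_nonneg (tdistT_nonneg _ x' x'') (by rw [hN'eq]; positivity)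
  calc |(u2 - u1) - (v2 - v1)| ≤ |u2 - u1| + |v2 - v1| := abs_sub _ _
    _ ≤ C₂ * (r' / N') * F + C₂ * (r / Nc) * F := add_le_add hfine hcoarse
    _ ≤ C₂ * (r' / N') * F + C₂ * (r' / N' + 1 / Nc) * F :=
        add_le_add le_rfl (mul_le_mul_of_nonneg_right (mul_le_mul_of_nonneg_left hrc hC₂.le) hF0)
    _ ≤ C₂ * (r' / N' + 1 / Nc) * F + C₂ * (r' / N' + 1 / Nc) * F := by
        have h1 : r' / N' ≤ r' / N' + 1 / Nc := by have := one_div_pos.mpr hNc0; linarith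
        have := mul_le_mul_of_nonneg_right (mul_le_mul_of_nonneg_left h1 hC₂.le) hF0
        linarith
    _ = 2 * C₂ * (r' / N' + 1 / Nc) * F := by ring

/-- **THE η-RATE OF THE HÖLDER ENTRY** (`0 ≤ α ≤ 1`, `0 ≤ γ ≤ 1`): for odd `L ≥ 3`, `a > 0`, `m₀² ≥ 0` there is `C > 0` (a function of `d, L, a, m₀², γ`;
NOT of `α`) such that for EVERY `K ≥ 1`, `n ≥ 1`, cube `2L^e`, mass `0 < m² ≤ m₀²`, source `|λ| ≤ F` on the coarse lattice and all fine points
`x′, x″` with `|x′ − x″| ≥ L^n` (`≥ η` in unit coordinates), the two-spacing difference `Δ = A₀′⁻¹(λ∘π) − (A₀⁻¹λ)∘π` satisfies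
`|Δ(x″) − Δ(x′)| ≤ C·(θ^K)^{1−α}·(|x′ − x″|∕N′)^α·F`, `θ = L^{−γ∕2}` — the order-`α` Hölder quotient of the two-spacing difference on unit cubes
carries the RATE `θ^{K(1−α)}`: interpolation (§1) between part P″'s sup rate `|Δ| ≤ C₁θ^K F` and the rate-free Lipschitz bound
`twoSpacingOp_sub_le` (`≤ 2C₂(|x′−x″|∕N′)F` once `|x′ − x″| ≥ L^n`).  An NE2-type HÖLDER-LAYER statement for King's full `A = 0` propagator,
decided in the model; not printed, not typed by `T4EtaRate`. [cite: King1986, (3.62) p.663, Prop. 3.8 (3.71) p.664; Balaban1985BackgroundPropagators, Thm 3.1 (3.43) p.397, Thm 3.14 pp.426–427] -/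
theorem twoSpacingOp_holder_rate (hLodd : Odd L) (hL : 2 ≤ L) {a : ℝ} (ha : 0 < a) {m0sq : ℝ} (hm0 : 0 ≤ m0sq) {γ : ℝ}
    (hγ0 : 0 ≤ γ) (hγ1 : γ ≤ 1) {α : ℝ} (hα0 : 0 ≤ α) (hα1 : α ≤ 1) :
    ∃ C : ℝ, 0 < C ∧ ∀ (K : ℕ), 1 ≤ K → ∀ (n : ℕ), 1 ≤ n →
      ∀ (e : ℕ) (M : Fin (d + 1) → ℕ) [∀ μ, NeZero (M μ)], (∀ μ, M μ = 2 * L ^ e) →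
      ∀ (msq : ℝ), 0 < msq → msq ≤ m0sq →
      ∀ (lam : Tor (fine (L ^ K) M) → ℝ) (F : ℝ), (∀ y, |lam y| ≤ F) → ∀ x' x'' : Tor (fine (L ^ n * L ^ K) M),
        ((L ^ n : ℕ) : ℝ) ≤ tdistT (fine (L ^ n * L ^ K) M) x' x'' →
        |(((fineOp (L ^ n * L ^ K) M (aK a L (K + n)) (((L ^ n * L ^ K : ℕ) : ℝ) ^ 2) msq)⁻¹
              *ᵥ (fun y' => lam (underPtN L K n M y'))) x''
            - ((fineOp (L ^ K) M (aK a L K) (((L ^ K : ℕ) : ℝ) ^ 2) msq)⁻¹ *ᵥ lam) (underPtN L K n M x''))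
          - (((fineOp (L ^ n * L ^ K) M (aK a L (K + n)) (((L ^ n * L ^ K : ℕ) : ℝ) ^ 2) msq)⁻¹
              *ᵥ (fun y' => lam (underPtN L K n M y'))) x'
            - ((fineOp (L ^ K) M (aK a L K) (((L ^ K : ℕ) : ℝ) ^ 2) msq)⁻¹ *ᵥ lam) (underPtN L K n M x'))|
          ≤ C * ((((L : ℝ) ^ (-(γ / 2))) ^ K) ^ (1 - α))
              * (tdistT (fine (L ^ n * L ^ K) M) x' x'' / ((L ^ n * L ^ K : ℕ) : ℝ)) ^ α * F := by
  have hL0 : (0 : ℝ) < L := by exact_mod_cast (show 0 < L by omega)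
  obtain ⟨C₁, hC₁, H₁⟩ := fullPropOp_rate_printed_sup (d := d) L hLodd hL ha hm0 hγ0 hγ1
  obtain ⟨C₂, hC₂, H₂⟩ := twoSpacingOp_sub_le (d := d) L hLodd hL ha hm0
  set A : ℝ := 2 * max C₁ C₂ with hAdef
  have hA : 0 < A := by have := le_max_left C₁ C₂; positivity
  refine ⟨A, hA, ?_⟩
  intro K hK n hn e M _ hM msq hmsq hcap lam F hF x' x'' hres
  set θK : ℝ := ((L : ℝ) ^ (-(γ / 2))) ^ K with hθKdef
  have hθK0 : 0 ≤ θK := pow_nonneg (Real.rpow_nonneg hL0.le _) K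
  set r' : ℝ := tdistT (fine (L ^ n * L ^ K) M) x' x'' with hr'def
  set N' : ℝ := ((L ^ n * L ^ K : ℕ) : ℝ) with hN'def
  set Nc : ℝ := ((L ^ K : ℕ) : ℝ) with hNcdef
  set Ln : ℝ := ((L ^ n : ℕ) : ℝ) with hLndef
  have hLn0 : 0 < Ln := by rw [hLndef]; exact_mod_cast pow_pos (show 0 < L by omega) n
  have hNc0 : 0 < Nc := by rw [hNcdef]; exact_mod_cast pow_pos (show 0 < L by omega) K
  have hN'eq : N' = Ln * Nc := by rw [hN'def, hLndef, hNcdef]; push_cast; ring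
  have hN'0 : 0 < N' := by rw [hN'eq]; positivity
  have hF0 : 0 ≤ F := (abs_nonneg _).trans (hF (underPtN L K n M x'))
  set q : ℝ := r' / N' with hqdef
  have hq0 : 0 ≤ q := div_nonneg (tdistT_nonneg _ x' x'') hN'0.le
  -- `1∕Nc ≤ q` (the pair is resolved by the coarse lattice)
  have hNq : 1 / Nc ≤ q := by
    rw [hqdef, hN'eq, div_le_div_iff₀ hNc0 (by positivity), one_mul]
    calc Ln * Nc = Nc * Ln := mul_comm _ _
      _ ≤ r' * Nc := by rw [mul_comm r']; exact mul_le_mul_of_nonneg_left hres hNc0.le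
  -- (a) the sup rate, twice
  have hs2 := H₁ K hK n hn e M hM msq hmsq hcap lam F hF x''
  have hs1 := H₁ K hK n hn e M hM msq hmsq hcap lam F hF x'
  -- (b) the rate-free Lipschitz bound
  have hb := H₂ K hK n hn e M hM msq hmsq hcap lam F hF x' x''
  set X : ℝ := |(((fineOp (L ^ n * L ^ K) M (aK a L (K + n)) (((L ^ n * L ^ K : ℕ) : ℝ) ^ 2) msq)⁻¹
              *ᵥ (fun y' => lam (underPtN L K n M y'))) x''
            - ((fineOp (L ^ K) M (aK a L K) (((L ^ K : ℕ) : ℝ) ^ 2) msq)⁻¹ *ᵥ lam) (underPtN L K n M x''))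
          - (((fineOp (L ^ n * L ^ K) M (aK a L (K + n)) (((L ^ n * L ^ K : ℕ) : ℝ) ^ 2) msq)⁻¹
              *ᵥ (fun y' => lam (underPtN L K n M y'))) x'
            - ((fineOp (L ^ K) M (aK a L K) (((L ^ K : ℕ) : ℝ) ^ 2) msq)⁻¹ *ᵥ lam) (underPtN L K n M x'))| with hXdef
  have h1 : X ≤ (A * F) * θK := by
    calc X ≤ C₁ * θK * F + C₁ * θK * F := (abs_sub _ _).trans (add_le_add hs2 hs1)
      _ = 2 * C₁ * F * θK := by ring
      _ ≤ A * F * θK := by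
          have : 2 * C₁ ≤ A := by rw [hAdef]; linarith [le_max_left C₁ C₂]
          have := mul_le_mul_of_nonneg_right (mul_le_mul_of_nonneg_right this hF0) hθK0
          linarith
  have h2 : X ≤ (A * F) * q := by
    calc X ≤ C₂ * (q + 1 / Nc) * F := hb
      _ ≤ C₂ * (q + q) * F := mul_le_mul_of_nonneg_right (mul_le_mul_of_nonneg_left (by linarith) hC₂.le) hF0
      _ = 2 * C₂ * F * q := by ring
      _ ≤ A * F * q := by
          have : 2 * C₂ ≤ A := by rw [hAdef]; linarith [le_max_right C₁ C₂]
          have := mul_le_mul_of_nonneg_right (mul_le_mul_of_nonneg_right this hF0) hq0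
          linarith
  have := le_interpolate_rpow (by positivity : 0 ≤ A * F) hθK0 hq0 hα0 hα1 h1 h2
  calc X ≤ A * F * θK ^ (1 - α) * q ^ α := this
    _ = A * θK ^ (1 - α) * q ^ α * F := by ring

end Summit.QuantumFields.YangMills.BalabanUVNodes.N15KingModelRung.Curved
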